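import Summits.QuantumFields.YangMills.Theorems.UnitScaleTiltProp7CmapTwSReadSet
import Summits.QuantumFields.YangMills.Theorems.UnitScaleTiltProp7DivRecoveryOfCover
import Summits.QuantumFields.YangMills.Theorems.UnitScaleTiltProp7Lane2PlateauCutoff
import Summits.QuantumFields.YangMills.Theorems.UnitScaleTiltProp7AxialGaugeFace
import Literature.MathematicalPhysics.QuantumFieldTheory.Balaban1983to89.B15Ineq137Local
import HarnessLib

/-!
# Route `UnitScaleTilt`, crux K1 «MinimiserStabilityRegPr» (stmt-QuantumFields-19200), LANE II «DIVERGENCE RECOVERY AT CURVED `W`» (★★OWNER RULING №23), [I-9]∕h9 input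
# (★p1 g19 RECIPE-hPatch step 4 «a `Qkc` read-set lemma»): **THE READ SET OF PRINT'S COMB OF RECORD `Q(W) = QTw W` AND OF THE SLOT FIBRES OF `Qkc W`**

Cell `ym3-torus` (HUMAN RULING D-0037, YM ladder rung R3 — YM₃ on T³ is a rung, NOT d = 4, NOT infinite volume, NOT a mass gap, NOT Clay; YM gap NOT proved), width seat
`ym-ust-19200-w1` (gen 16).  THEOREMS ONLY (0 `def`, 0 `sorry`); `--supports stmt-QuantumFields-19200 --as helper`; count-neutral.

THE GEOMETRY (located, not chosen).  The twisted chart of record `U̿^{tw}(A)(c) = w_A(c₋)⁻¹ · D̄_GL(e^{A}W)(c) · w_A(c₊) · D̄_GL(W)(c)⁻¹` (✓`Prop7SymAvgTw.dbarTw`) mixes the two block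
conventions of the tree (DIVERGENCE F3 of `Setup`): the descended fields `D̄_GL` read the CENTRED torus blocks `B^k(ĉ₋) ∪ B^k(ĉ₊)` (`iterBlockOf`, ✓`Prop7CmapTwSReadSet.descendToGL_congr_of_agree`),
while the accumulated comb frames `w_A(y) = wrec L W♯ (e^{A})♯ k (coordT3 y)` (✓`frameTw`) are the `ℤ³`-lane frames of [Balaban1985Averaging] (85) on the CORNER boxes `Lᵏz + [0, Lᵏ)³`
pulled back at the `k`-centre `basePt = embIter k 0` (✓`Prop7SPrint.basePt`: «corner-anchored blocks anchored AT the k-centres») — i.e. on the boxes `embIter k ŷ + [0, Lᵏ)³`, which sit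
HALF A BLOCK off the torus blocks (the same fact px9 g7 recorded for the comb means, 2026-08-29).  Consequently the read set of `Q(W)` at `c` is NOT the two torus blocks of `ĉ`: it is
contained in the blocks within coarse cyclic sup-distance `2` of `ĉ₋` (two blocks + the `+`-side half-block fringe of each), and this is the predicate used below.

WHAT IS PROVED (sorry-free, no definition; `ĉ := bondShift (sites_eq F n K h) c`, `k = K − n`, `ℓ = Lᵏ`; the read predicate of a fine bond `b` at `c` is spelled INLINE:
`∀ κ, dist((B^k b₋)_κ, (ĉ₋)_κ) ≤ 2 ∧ dist((B^k b₊)_κ, (ĉ₋)_κ) ≤ 2`, `dist(a, b) = min (a − b).val (b − a).val` the cyclic distance of ✓`Prop7Lane2PlateauCutoff`).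
* §1 `frameTw_congr_of_agree_box` — the frame `w_A(y)` reads `A` only on the bonds `⟨basePt + x, κ⟩` with `x, x + e_κ ∈ ℓ·coordT3 y + [0, ℓ)³` (lit ✓`B15Ineq137Local.wrec_congr`);
  `dist_iterBlockOf_transl_basePt_le_one` — those sites have `k`-blocks within cyclic distance `1` of `ŷ` (label arithmetic with the centre offset `off`, `2·off + 1 ≤ ℓ`,
  ✓`Prop7AxialGaugeFace.exists_off_embIter`); hence ★`frameTw_congr_of_agree` (block form).
* §2 ★`dbarTw_congr_of_agree`, ★`logChartTw_congr_of_agree` — the twisted double bar and its log read `A` only on the read set.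
* §3 ★★`QTw_apply_eq_zero_of_vanish_on_reads` — at `W ∈ RegPr F n K e`, `10⁹·L³·e ≤ 1` (✓`Prop7CoverQkc.differentiableAt_logChartTw_of_regPr`): `Q(W)δ(c) = 0` when `δ` vanishes
  on the read set of `c` (the line `t ↦ log U̿^{tw}(t•δ)(c)` is constant); ★`QTw_congr_of_agree`.
* §4 the slot letter: ★★`fibre_Qkc_congr_of_agree` — the fibre `WL2.equiv (Qkc W f) (bondShift⁻¹ ĉ)` depends on `f : BondL2K` only through its readings `toL2⁻¹ f b` on the read
  set of `ĉ`; ★★★`fibre_Qkc_mul_eq_of_eq_one_on_reads` — for a bond multiplier `Zb` with reading `toL2⁻¹(Zb f) b = ζ(b₋)•toL2⁻¹ f b` ((Z2) of ✓`exists_cutoffPackage`) and `ζ = 1`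
  on every fine site whose block is within cyclic distance `2` of `ĉ₋`, `fibre (Qkc W (Zb f)) ĉ = fibre (Qkc W f) ĉ` — with ✓`plateauCutoff_eq_one_of_block_near` (radius `L^s + 2`)
  this is the `ζ̃`-transparency of the `As`-sums on the inner coarse bonds (`ĉ₋` within `L^s` of the centre) that h9 of [I-9] reads.
HONEST SCOPE.  Locality bookkeeping over the definitions of record; no estimate; nothing of (REC)∕`hPatch`∕hN06∕EX∕the crux is claimed.

References: T. Bałaban, CMP **98** (1985) 17–51 [Balaban1985Averaging] ((85) p.31, (89) p.31, (97) p.32, (110) p.34, p.24); CMP **99** (1985) 389–434 [Balaban1985BackgroundPropagators]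
((3.13) p.392, (3.14)–(3.16) p.393); CMP **102** (1985) 277–309 [Balaban1985Variational] ((44) p.285); CMP **109** (1987) 249–301 [Balaban1987RG1] ((0.1) p.251–252).
-/

set_option autoImplicit false

noncomputable section

namespace Summit.QuantumFields.YangMills.Theorems.Prop7QkcReadSet

open scoped Matrix.Norms.L2Operator InnerProductSpace BigOperators
open NormedSpace Metric Set
open Literature.MathematicalPhysics.QuantumFieldTheory.Balaban1983to89
open Literature.MathematicalPhysics.QuantumFieldTheory.Balaban1983to89.T3ContinuumYM3Torus
open T4Continuum BlockAveraging ExpMeanLog MatrixLog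
open T3PrintedRegularMinimiser (RegPr)
open T3PrintedRegularOrbits (sites_eq)
open T3SectALandauChart (eta eta_pos bgUnits)
open T3LevelShift (siteShift bondShift bondShift_src bondShift_tgt)
open B7Prop1Explicit (expUnit)
open B5Eq118OneStroke (iterBlockOf val_iterBlockOf)
open B15DeterminingSets (embIter)
open B10Eq27TorusAxialLog (transl transl_apply transl_add_e pull)
open MatrixLog (mlog)
open Summit.QuantumFields.YangMills.Theorems.Prop7SPrint (basePt)
open Summit.QuantumFields.YangMills.Theorems.Prop7SymAvgGL (descendToGL)
open Summit.QuantumFields.YangMills.Theorems.Prop7SymAvgTw (coordT3 coordT3_apply frameTw frameTw_def dbarTw dbarTw_def logChartTw logChartTw_apply QTw QTw_def)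
open Summit.QuantumFields.YangMills.Theorems.Prop7CmapTwSReadSet (height_le descendToGL_congr_of_agree)
open Summit.QuantumFields.YangMills.Theorems.Prop7CoverQkc (differentiableAt_logChartTw_of_regPr)
open Summit.QuantumFields.YangMills.Theorems.Prop7AxialGaugeFace (exists_off_embIter)
open Summit.QuantumFields.YangMills.Theorems.Prop7SectET3Transport (periodsT3)
open Summit.QuantumFields.YangMills.Theorems.Prop7SectET3HilbertLetters (W₂ toL2 toL2B toL2B_apply toL2_symm_apply)
open Summit.QuantumFields.YangMills.Theorems.Prop7SectET3CombLetters (Qkc Qkc_toL2)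
open Summit.QuantumFields.YangMills.Theorems.Prop7Lane2PlateauCutoff (cycDist_triangle)
open B11Eq103H1Complex (BondL2K)
open B9Eq311L2Pairing (WL2)

variable (F : T3Family) (n K : ℕ) (h : n ≤ K)

/-! ## §1 The frame `w_A(y)` reads the box `embIter k ŷ + [0, ℓ)³` — blocks within cyclic distance `1` of `ŷ` -/

section Frame

/-- **THE FRAME READS ONE CORNER BOX ANCHORED AT THE CENTRE** (`ℤ³`-lane form): `w_A(y) = wrec L W♯ (e^{A})♯ k z`, `z = coordT3 y`, depends on `A` only through the torus bonds
`⟨basePt + x, κ⟩` with `x` and `x + e_κ` in the box `ℓz ≤ x ≤ ℓz + (ℓ − 1)𝟙` — lit ✓`B15Ineq137Local.wrec_congr` read through ✓`pull`. [cite: Balaban1985Averaging, (85) p.31, p.24] -/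
theorem frameTw_congr_of_agree_box (U₀ : GaugeField (F.P K) 0 (Matrix.specialUnitaryGroup (Fin 2) ℂ)) {A A' : PBond (F.P K) 0 → Matrix (Fin 2) (Fin 2) ℂ}
    (y : Site (F.P n) 0)
    (hAA' : ∀ (x : B7Prop1Explicit.Site (F.P K).d) (κ : Fin (F.P K).d),
      B7Prop1Local.InBox (B7Prop1Local.loK (F.P K).L (K - n) (coordT3 F n K h y))
          (fun i => B7Prop1Local.loK (F.P K).L (K - n) (coordT3 F n K h y) i + (((F.P K).L : ℤ) ^ (K - n) - 1)) x →
      B7Prop1Local.InBox (B7Prop1Local.loK (F.P K).L (K - n) (coordT3 F n K h y))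
          (fun i => B7Prop1Local.loK (F.P K).L (K - n) (coordT3 F n K h y) i + (((F.P K).L : ℤ) ^ (K - n) - 1)) (x + B7Prop1Explicit.e κ) →
      A ⟨transl (basePt F n K) x, κ⟩ = A' ⟨transl (basePt F n K) x, κ⟩) :
    frameTw F n K h U₀ A y = frameTw F n K h U₀ A' y := by
  rw [frameTw_def, frameTw_def]
  have hL : 1 ≤ (F.P K).L := by have := F.hL.2; show 1 ≤ F.L; omega
  exact B15Ineq137Local.wrec_congr hL _ (K - n) (coordT3 F n K h y) fun x κ hx hxκ => by
    simp only [B10Eq27TorusAxialLog.pull_apply, hAA' x κ hx hxκ]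

/-- Label arithmetic: `((ℓ·a + s) mod ℓN) div ℓ = a mod N` for `s < ℓ`. [folklore] -/
theorem mul_add_mod_mul_div {ℓ N a s : ℕ} (hℓ : 0 < ℓ) (hN : 0 < N) (hs : s < ℓ) : (ℓ * a + s) % (ℓ * N) / ℓ = a % N := by
  have h1 : ℓ * a + s = ℓ * N * (a / N) + (ℓ * (a % N) + s) := by
    calc ℓ * a + s = ℓ * (N * (a / N) + a % N) + s := by rw [Nat.div_add_mod]
      _ = ℓ * N * (a / N) + (ℓ * (a % N) + s) := by ring
  have h2 : ℓ * (a % N) + s < ℓ * N := by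
    have h3 := Nat.mod_lt a hN
    calc ℓ * (a % N) + s < ℓ * (a % N) + ℓ := by omega
      _ = ℓ * (a % N + 1) := by ring
      _ ≤ ℓ * N := Nat.mul_le_mul_left _ h3
  rw [h1, Nat.mul_add_mod, Nat.mod_eq_of_lt h2, Nat.mul_add_div hℓ, Nat.div_eq_of_lt hs, add_zero]

include h in
/-- **THE BOX SITES LIE IN THE BLOCKS NEXT TO `Y`** (label arithmetic with the centre offset): for `x ∈ ℓ·val(Y) + [0, ℓ)³`, every coordinate of the `k`-block of `basePt + x` is `Y_κ` or
`Y_κ + 1`, hence within cyclic distance `1` of `Y` (`basePt = embIter k 0` has labels `off`, `2·off + 1 ≤ ℓ` (✓`exists_off_embIter`), so the label `off + ℓY_κ + r`, `r < ℓ`, has block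
index `Y_κ + (off + r) div ℓ`). [cite: Balaban1987RG1, (0.1) p.251–252; Balaban1984PropagatorsI, (1.6) p.18] -/
theorem dist_iterBlockOf_transl_basePt_le_one (Y : Site (F.P K) (K - n)) (x : B7Prop1Explicit.Site (F.P K).d)
    (hx : ∀ ν : Fin (F.P K).d, ((F.P K).L : ℤ) ^ (K - n) * ((Y ν).val : ℤ) ≤ x ν ∧ x ν ≤ ((F.P K).L : ℤ) ^ (K - n) * ((Y ν).val : ℤ) + (((F.P K).L : ℤ) ^ (K - n) - 1))
    (ν : Fin (F.P K).d) :
    min ((iterBlockOf (K - n) (transl (basePt F n K) x)) ν - Y ν).val (Y ν - (iterBlockOf (K - n) (transl (basePt F n K) x)) ν).val ≤ 1 := by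
  have hk : K - n ≤ (F.P K).m + (F.P K).K := height_le F n K
  -- letters
  set ℓ : ℕ := (F.P K).L ^ (K - n) with hℓ
  set N : ℕ := (F.P K).sitesPerDir (K - n) with hN
  have hL1 : 1 ≤ (F.P K).L := by have := F.hL.2; show 1 ≤ F.L; omega
  have hℓpos : 0 < ℓ := pow_pos (by omega) _
  have hNpos : 0 < N := Nat.pos_of_ne_zero (NeZero.ne _)
  have hN0 : (F.P K).sitesPerDir 0 = ℓ * N := Prop7QprimeCombL2.sitesPerDir_zero_eq F n K h
  -- the centre offset
  obtain ⟨off, hoff2, hoff⟩ := exists_off_embIter (P := F.P K) (K - n) hk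
  have hb : ((basePt F n K) ν).val = off := by
    have h0 := hoff (0 : Site (F.P K) (K - n)) ν
    rw [show ((0 : Site (F.P K) (K - n)) ν) = 0 from rfl, ZMod.val_zero, zero_mul, zero_add] at h0
    exact h0
  -- the remainder `r` of `x ν` in its box
  obtain ⟨hx1, hx2⟩ := hx ν
  have hℓZ : (((F.P K).L : ℤ) ^ (K - n)) = ((ℓ : ℕ) : ℤ) := by rw [hℓ, Nat.cast_pow]
  rw [hℓZ] at hx1 hx2
  obtain ⟨r, hr⟩ := Int.eq_ofNat_of_zero_le (show (0 : ℤ) ≤ x ν - (ℓ : ℤ) * ((Y ν).val : ℤ) by omega)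
  have hrℓ : r < ℓ := by
    have h1 : (r : ℤ) ≤ (ℓ : ℤ) - 1 := by omega
    omega
  have hxr : x ν = ((ℓ * (Y ν).val + r : ℕ) : ℤ) := by push_cast; omega
  -- `q := (off + r) div ℓ ∈ {0, 1}`
  set q : ℕ := (off + r) / ℓ with hq
  have hq1 : q ≤ 1 := by
    rw [hq]
    exact Nat.lt_succ_iff.mp (Nat.div_lt_of_lt_mul (by omega))
  -- the label of `basePt + x` and its block index
  have hX : (transl (basePt F n K) x) ν = (((ℓ * ((Y ν).val + q) + (off + r) % ℓ : ℕ)) : ZMod ((F.P K).sitesPerDir 0)) := by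
    rw [transl_apply, ← ZMod.natCast_zmod_val ((basePt F n K) ν), hb, hxr, Int.cast_natCast, ← Nat.cast_add]
    congr 1
    have h3 := Nat.div_add_mod (off + r) ℓ
    rw [← hq] at h3
    calc off + (ℓ * (Y ν).val + r) = ℓ * (Y ν).val + (off + r) := by ring
      _ = ℓ * (Y ν).val + (ℓ * q + (off + r) % ℓ) := by rw [h3]
      _ = ℓ * ((Y ν).val + q) + (off + r) % ℓ := by ring
  have hB : iterBlockOf (K - n) (transl (basePt F n K) x) ν = Y ν + (q : ZMod N) := by
    have hval : ((iterBlockOf (K - n) (transl (basePt F n K) x)) ν).val = ((Y ν).val + q) % N := by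
      rw [val_iterBlockOf (P := F.P K) (K - n) hk, hX, ZMod.val_natCast, hN0]
      exact mul_add_mod_mul_div hℓpos hNpos (Nat.mod_lt _ hℓpos)
    rw [← ZMod.natCast_zmod_val ((iterBlockOf (K - n) (transl (basePt F n K) x)) ν), hval, ZMod.natCast_mod, Nat.cast_add,
      ZMod.natCast_zmod_val]
  rw [hB, add_sub_cancel_left, ZMod.val_natCast]
  exact (min_le_left _ _).trans ((Nat.mod_le _ _).trans hq1)

/-- ★ **THE FRAME READS THE BLOCKS WITHIN DISTANCE `1` OF `Y`** (block form of `frameTw_congr_of_agree_box`, the comparison site read through the level identification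
`y = siteShift⁻¹ Y`): if `A = A′` on every fine bond whose endpoint `k`-blocks are within cyclic sup-distance `1` of `Y`, then `w_A(y) = w_{A′}(y)`.
[cite: Balaban1985Averaging, (85) p.31, (97) p.32, (110) p.34] -/
theorem frameTw_congr_of_agree (U₀ : GaugeField (F.P K) 0 (Matrix.specialUnitaryGroup (Fin 2) ℂ)) {A A' : PBond (F.P K) 0 → Matrix (Fin 2) (Fin 2) ℂ}
    (Y : Site (F.P K) (K - n))
    (hAA' : ∀ b : PBond (F.P K) 0,
      (∀ κ : Fin (F.P K).d, min ((iterBlockOf (K - n) b.src) κ - Y κ).val (Y κ - (iterBlockOf (K - n) b.src) κ).val ≤ 1) →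
      (∀ κ : Fin (F.P K).d, min ((iterBlockOf (K - n) b.tgt) κ - Y κ).val (Y κ - (iterBlockOf (K - n) b.tgt) κ).val ≤ 1) →
      A b = A' b) :
    frameTw F n K h U₀ A ((siteShift (sites_eq F n K h)).symm Y) = frameTw F n K h U₀ A' ((siteShift (sites_eq F n K h)).symm Y) := by
  have hc : ∀ i, B7Prop1Local.loK (F.P K).L (K - n) (coordT3 F n K h ((siteShift (sites_eq F n K h)).symm Y)) i
      = ((F.P K).L : ℤ) ^ (K - n) * ((Y i).val : ℤ) := by
    intro i
    have h1 : (siteShift (sites_eq F n K h)) ((siteShift (sites_eq F n K h)).symm Y) i = Y i :=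
      congrFun ((siteShift (sites_eq F n K h)).apply_symm_apply Y) i
    show ((F.P K).L : ℤ) ^ (K - n) * ((((siteShift (sites_eq F n K h)) ((siteShift (sites_eq F n K h)).symm Y) i).val : ℕ) : ℤ) = _
    rw [h1]
    rfl
  have hbox : ∀ x : B7Prop1Explicit.Site (F.P K).d,
      B7Prop1Local.InBox (B7Prop1Local.loK (F.P K).L (K - n) (coordT3 F n K h ((siteShift (sites_eq F n K h)).symm Y)))
          (fun i => B7Prop1Local.loK (F.P K).L (K - n) (coordT3 F n K h ((siteShift (sites_eq F n K h)).symm Y)) i + (((F.P K).L : ℤ) ^ (K - n) - 1)) x →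
      ∀ ν : Fin (F.P K).d, ((F.P K).L : ℤ) ^ (K - n) * ((Y ν).val : ℤ) ≤ x ν ∧ x ν ≤ ((F.P K).L : ℤ) ^ (K - n) * ((Y ν).val : ℤ) + (((F.P K).L : ℤ) ^ (K - n) - 1) := by
    intro x hx ν
    have h1 := hx ν
    dsimp only at h1
    rw [hc ν] at h1
    exact h1
  refine frameTw_congr_of_agree_box F n K h U₀ _ fun x κ hx hxκ => hAA' ⟨transl (basePt F n K) x, κ⟩ ?_ ?_
  · exact dist_iterBlockOf_transl_basePt_le_one F n K h Y x (hbox x hx)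
  · intro ν
    have ht : (⟨transl (basePt F n K) x, κ⟩ : PBond (F.P K) 0).tgt = transl (basePt F n K) (x + B7Prop1Explicit.e κ) := (transl_add_e _ _ _).symm
    rw [ht]
    exact dist_iterBlockOf_transl_basePt_le_one F n K h Y (x + B7Prop1Explicit.e κ) (hbox _ hxκ) ν

end Frame

/-! ## §2 The twisted double bar and its log read the read set of `c` -/

section Values

/-- ★ **THE TWISTED DOUBLE BAR IS LOCAL**: `U̿^{tw}(A)(c)` depends on `A` only through the fine bonds whose endpoint `k`-blocks are within cyclic sup-distance `2` of `ĉ₋`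
(frames at `ĉ₋`, `ĉ₊`: blocks next to `ĉ₋`∕`ĉ₊`; descended perturbation: the two blocks `ĉ₋, ĉ₊`; the descended background reads nothing of `A`).
[cite: Balaban1985Averaging, (89) p.31, (97) p.32, (110) p.34; Balaban1987RG1, (0.4) p.253] -/
theorem dbarTw_congr_of_agree (U₀ : GaugeField (F.P K) 0 (Matrix.specialUnitaryGroup (Fin 2) ℂ)) {A A' : PBond (F.P K) 0 → Matrix (Fin 2) (Fin 2) ℂ}
    (chat : PBond (F.P K) (K - n))
    (hAA' : ∀ b : PBond (F.P K) 0,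
      (∀ κ : Fin (F.P K).d, min ((iterBlockOf (K - n) b.src) κ - chat.src κ).val (chat.src κ - (iterBlockOf (K - n) b.src) κ).val ≤ 2) →
      (∀ κ : Fin (F.P K).d, min ((iterBlockOf (K - n) b.tgt) κ - chat.src κ).val (chat.src κ - (iterBlockOf (K - n) b.tgt) κ).val ≤ 2) →
      A b = A' b) :
    dbarTw F n K h U₀ A ((bondShift (sites_eq F n K h)).symm chat) = dbarTw F n K h U₀ A' ((bondShift (sites_eq F n K h)).symm chat) := by
  -- the two endpoints of `c = bondShift⁻¹ ĉ` through the level identification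
  set c : PBond (F.P n) 0 := (bondShift (sites_eq F n K h)).symm chat with hc
  have hcc : bondShift (sites_eq F n K h) c = chat := by rw [hc, Equiv.apply_symm_apply]
  have hsrc : c.src = (siteShift (sites_eq F n K h)).symm chat.src := rfl
  have htgt : c.tgt = (siteShift (sites_eq F n K h)).symm chat.tgt := by
    have h1 := bondShift_tgt (sites_eq F n K h) c
    rw [hcc] at h1
    exact ((Equiv.symm_apply_eq _).2 h1).symm
  -- the one-step distance at the coarse bond: `dist(ĉ₊, ĉ₋) ≤ 1`
  have hts : ∀ κ : Fin (F.P K).d, min (chat.tgt κ - chat.src κ).val (chat.src κ - chat.tgt κ).val ≤ 1 := by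
    intro κ
    refine (min_le_left _ _).trans ?_
    show ((Function.update chat.src chat.dir (chat.src chat.dir + 1)) κ - chat.src κ).val ≤ 1
    by_cases hκ : κ = chat.dir
    · subst hκ
      rw [Function.update_self, add_sub_cancel_left, ZMod.val_one_eq_one_mod]
      exact Nat.mod_le _ _
    · rw [Function.update_of_ne hκ, sub_self, ZMod.val_zero]
      exact zero_le_one
  have hss : ∀ κ : Fin (F.P K).d, min (chat.src κ - chat.src κ).val (chat.src κ - chat.src κ).val ≤ 2 := by
    intro κ; rw [sub_self, ZMod.val_zero, min_self]; exact Nat.zero_le _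
  have hts2 : ∀ κ : Fin (F.P K).d, min (chat.tgt κ - chat.src κ).val (chat.src κ - chat.tgt κ).val ≤ 2 := fun κ => (hts κ).trans one_le_two
  -- blocks in `{ĉ₋, ĉ₊}` are within distance `2` of `ĉ₋`
  have hmem : ∀ x : Site (F.P K) 0, (iterBlockOf (K - n) x = chat.src ∨ iterBlockOf (K - n) x = chat.tgt) →
      ∀ κ : Fin (F.P K).d, min ((iterBlockOf (K - n) x) κ - chat.src κ).val (chat.src κ - (iterBlockOf (K - n) x) κ).val ≤ 2 := by
    rintro x (hx | hx) κ <;> rw [hx]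
    exacts [hss κ, hts2 κ]
  -- blocks within distance `1` of `ĉ₊` are within distance `2` of `ĉ₋`
  have htri : ∀ x : Site (F.P K) 0, (∀ κ : Fin (F.P K).d, min ((iterBlockOf (K - n) x) κ - chat.tgt κ).val (chat.tgt κ - (iterBlockOf (K - n) x) κ).val ≤ 1) →
      ∀ κ : Fin (F.P K).d, min ((iterBlockOf (K - n) x) κ - chat.src κ).val (chat.src κ - (iterBlockOf (K - n) x) κ).val ≤ 2 := by
    intro x hx κ
    have h1 := cycDist_triangle ((iterBlockOf (K - n) x) κ) (chat.tgt κ) (chat.src κ)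
    have h2 := hx κ
    have h3 := hts κ
    omega
  rw [dbarTw_def, dbarTw_def, hsrc, htgt]
  rw [frameTw_congr_of_agree F n K h U₀ chat.src (A := A) (A' := A') fun b hbs hbt =>
      hAA' b (fun κ => (hbs κ).trans one_le_two) (fun κ => (hbt κ).trans one_le_two),
    frameTw_congr_of_agree F n K h U₀ chat.tgt (A := A) (A' := A') fun b hbs hbt => hAA' b (htri _ hbs) (htri _ hbt),
    descendToGL_congr_of_agree F n K h c
      (W := fun b => expUnit (A b) * bgUnits F K U₀ b) (W' := fun b => expUnit (A' b) * bgUnits F K U₀ b) fun b hbs hbt => by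
        rw [hcc] at hbs hbt
        simp only [hAA' b (hmem _ hbs) (hmem _ hbt)]]

/-- ★ **THE TWISTED LOG-CHART IS LOCAL** (bondwise `mlog` of the double bar). [cite: Balaban1985BackgroundPropagators, (3.13) p.392, (3.14) p.393; Balaban1985Averaging, (110) p.34] -/
theorem logChartTw_congr_of_agree (U₀ : GaugeField (F.P K) 0 (Matrix.specialUnitaryGroup (Fin 2) ℂ)) {A A' : PBond (F.P K) 0 → Matrix (Fin 2) (Fin 2) ℂ}
    (chat : PBond (F.P K) (K - n))
    (hAA' : ∀ b : PBond (F.P K) 0,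
      (∀ κ : Fin (F.P K).d, min ((iterBlockOf (K - n) b.src) κ - chat.src κ).val (chat.src κ - (iterBlockOf (K - n) b.src) κ).val ≤ 2) →
      (∀ κ : Fin (F.P K).d, min ((iterBlockOf (K - n) b.tgt) κ - chat.src κ).val (chat.src κ - (iterBlockOf (K - n) b.tgt) κ).val ≤ 2) →
      A b = A' b) :
    logChartTw F n K h U₀ A ((bondShift (sites_eq F n K h)).symm chat) = logChartTw F n K h U₀ A' ((bondShift (sites_eq F n K h)).symm chat) := by
  rw [logChartTw_apply, logChartTw_apply, dbarTw_congr_of_agree F n K h U₀ chat hAA']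

end Values

/-! ## §3 `Q(W)δ(c) = 0` when `δ` vanishes on the read set; `Q(W)` is local -/

section Linear

variable {e : ℝ} (he : 0 < e) (hw : 10 ^ 9 * (F.L : ℝ) ^ 3 * e ≤ 1)
  (W : GaugeField (F.P K) 0 (Matrix.specialUnitaryGroup (Fin 2) ℂ)) (hreg : RegPr F n K e W)

include he hw hreg in
/-- ★★ **`Q(W)δ(c) = 0` WHEN `δ` VANISHES ON THE READ SET OF `c`** (`Q(W) := fderiv (log U̿^{tw}) 0`, differentiable at `0` on `RegPr` with `10⁹L³e ≤ 1`; the line `t ↦ log U̿^{tw}(t•δ)(c)`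
is constant by §2). [cite: Balaban1985BackgroundPropagators, (3.14) p.393; Balaban1985Averaging, (110) p.34] -/
theorem QTw_apply_eq_zero_of_vanish_on_reads (δ : PBond (F.P K) 0 → Matrix (Fin 2) (Fin 2) ℂ) (chat : PBond (F.P K) (K - n))
    (hδ : ∀ b : PBond (F.P K) 0,
      (∀ κ : Fin (F.P K).d, min ((iterBlockOf (K - n) b.src) κ - chat.src κ).val (chat.src κ - (iterBlockOf (K - n) b.src) κ).val ≤ 2) →
      (∀ κ : Fin (F.P K).d, min ((iterBlockOf (K - n) b.tgt) κ - chat.src κ).val (chat.src κ - (iterBlockOf (K - n) b.tgt) κ).val ≤ 2) →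
      δ b = 0) :
    QTw F n K h W δ ((bondShift (sites_eq F n K h)).symm chat) = 0 := by
  have hd : DifferentiableAt ℂ (logChartTw F n K h W) 0 := differentiableAt_logChartTw_of_regPr F h he hw W hreg
  -- the line through `0` in the direction `δ`
  have hline : HasDerivAt (fun t : ℂ => t • δ) δ 0 := by
    simpa using ((hasDerivAt_id (0 : ℂ)).smul_const δ)
  have h0 : (0 : ℂ) • δ = 0 := zero_smul _ _
  have hcomp : HasDerivAt (fun t : ℂ => logChartTw F n K h W (t • δ)) (fderiv ℂ (logChartTw F n K h W) 0 δ) 0 := by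
    have hd' : HasFDerivAt (logChartTw F n K h W) (fderiv ℂ (logChartTw F n K h W) 0) ((0 : ℂ) • δ) := by
      rw [h0]; exact hd.hasFDerivAt
    exact hd'.comp_hasDerivAt (0 : ℂ) hline
  have hc : HasDerivAt (fun t : ℂ => logChartTw F n K h W (t • δ) ((bondShift (sites_eq F n K h)).symm chat)) (fderiv ℂ (logChartTw F n K h W) 0 δ ((bondShift (sites_eq F n K h)).symm chat)) 0 :=
    (hasDerivAt_pi.1 hcomp) ((bondShift (sites_eq F n K h)).symm chat)
  -- … which is constant in `t`
  have hconst : (fun t : ℂ => logChartTw F n K h W (t • δ) ((bondShift (sites_eq F n K h)).symm chat)) = fun _ => logChartTw F n K h W 0 ((bondShift (sites_eq F n K h)).symm chat) := by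
    funext t
    exact logChartTw_congr_of_agree F n K h W chat fun b hbs hbt => by rw [Pi.smul_apply, hδ b hbs hbt, smul_zero, Pi.zero_apply]
  rw [hconst] at hc
  rw [QTw_def]
  exact hc.unique (hasDerivAt_const (0 : ℂ) _)

include he hw hreg in
/-- ★ **`Q(W)` IS LOCAL**: `Q(W)A(c) = Q(W)A′(c)` when `A = A′` on the read set of `c` (linearity + `QTw_apply_eq_zero_of_vanish_on_reads`).
[cite: Balaban1985BackgroundPropagators, (3.14) p.393] -/
theorem QTw_congr_of_agree {A A' : PBond (F.P K) 0 → Matrix (Fin 2) (Fin 2) ℂ} (chat : PBond (F.P K) (K - n))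
    (hAA' : ∀ b : PBond (F.P K) 0,
      (∀ κ : Fin (F.P K).d, min ((iterBlockOf (K - n) b.src) κ - chat.src κ).val (chat.src κ - (iterBlockOf (K - n) b.src) κ).val ≤ 2) →
      (∀ κ : Fin (F.P K).d, min ((iterBlockOf (K - n) b.tgt) κ - chat.src κ).val (chat.src κ - (iterBlockOf (K - n) b.tgt) κ).val ≤ 2) →
      A b = A' b) :
    QTw F n K h W A ((bondShift (sites_eq F n K h)).symm chat) = QTw F n K h W A' ((bondShift (sites_eq F n K h)).symm chat) := by
  have h0 := QTw_apply_eq_zero_of_vanish_on_reads F n K h he hw W hreg (A - A') chat fun b hbs hbt => by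
    rw [Pi.sub_apply, hAA' b hbs hbt, sub_self]
  have h1 : QTw F n K h W (A - A') ((bondShift (sites_eq F n K h)).symm chat)
      = QTw F n K h W A ((bondShift (sites_eq F n K h)).symm chat) - QTw F n K h W A' ((bondShift (sites_eq F n K h)).symm chat) := by
    rw [map_sub]; rfl
  rw [h1] at h0
  exact sub_eq_zero.1 h0

end Linear

/-! ## §4 The slot letter `Qkc W`: its fibre at `ĉ` reads `f` only on the read set of `ĉ` -/

section Slot

variable {c₀ cB : ℝ}
variable {e : ℝ} (he : 0 < e) (hw : 10 ^ 9 * (F.L : ℝ) ^ 3 * e ≤ 1)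
  (W : GaugeField (F.P K) 0 (Matrix.specialUnitaryGroup (Fin 2) ℂ)) (hreg : RegPr F n K e W)

include he hw hreg in
/-- ★★ **THE FIBRE OF `Qkc W f` AT `ĉ` READS `f` ONLY ON THE READ SET OF `ĉ`**: for `f f′ : BondL2K` whose bond readings `toL2⁻¹ f b` agree on every fine bond `b` with endpoint
`k`-blocks within cyclic sup-distance `2` of `ĉ₋`, the fibres of `Qkc W f` and `Qkc W f′` at `bondShift⁻¹ ĉ` coincide (`Qkc = η•toL2B∘QTw∘toL2⁻¹`, §3).
[cite: Balaban1985Variational, (44) p.285; Balaban1985BackgroundPropagators, (3.14)–(3.16) p.393] -/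
theorem fibre_Qkc_congr_of_agree (f f' : BondL2K ℂ 3 (periodsT3 F K) c₀ W₂) (chat : PBond (F.P K) (K - n))
    (hff' : ∀ b : PBond (F.P K) 0,
      (∀ κ : Fin (F.P K).d, min ((iterBlockOf (K - n) b.src) κ - chat.src κ).val (chat.src κ - (iterBlockOf (K - n) b.src) κ).val ≤ 2) →
      (∀ κ : Fin (F.P K).d, min ((iterBlockOf (K - n) b.tgt) κ - chat.src κ).val (chat.src κ - (iterBlockOf (K - n) b.tgt) κ).val ≤ 2) →
      (toL2 F K c₀).symm f b = (toL2 F K c₀).symm f' b) :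
    WL2.equiv ℂ (fun _ : PBond (F.P n) 0 => cB) W₂ (Qkc F n K h c₀ cB W f) ((bondShift (sites_eq F n K h)).symm chat)
      = WL2.equiv ℂ (fun _ : PBond (F.P n) 0 => cB) W₂ (Qkc F n K h c₀ cB W f') ((bondShift (sites_eq F n K h)).symm chat) := by
  obtain ⟨A, rfl⟩ : ∃ A, f = toL2 F K c₀ A := ⟨(toL2 F K c₀).symm f, ((toL2 F K c₀).apply_symm_apply f).symm⟩
  obtain ⟨A', rfl⟩ : ∃ A', f' = toL2 F K c₀ A' := ⟨(toL2 F K c₀).symm f', ((toL2 F K c₀).apply_symm_apply f').symm⟩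
  simp only [LinearEquiv.symm_apply_apply] at hff'
  rw [Qkc_toL2, Qkc_toL2, WL2.equiv_smul, WL2.equiv_smul, Pi.smul_apply, Pi.smul_apply, toL2B_apply, toL2B_apply,
    QTw_congr_of_agree F n K h he hw W hreg chat hff']

include he hw hreg in
/-- ★★★ **THE SLOT FIBRES ARE TRANSPARENT TO A CUTOFF THAT IS `1` NEAR `ĉ`** (the consumer row of [I-9]∕h9): for a bond multiplier `Zb` reading `toL2⁻¹(Zb f) b = ζ(b₋) • toL2⁻¹ f b`
((Z2) of ✓`exists_cutoffPackage`, or the `ζ̃`-multiplier built the same way) with `ζ x = 1` at every fine site `x` whose `k`-block is within cyclic sup-distance `2` of `ĉ₋`,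
`fibre (Qkc W (Zb f)) ĉ = fibre (Qkc W f) ĉ`.  With ✓`plateauCutoff_eq_one_of_block_near` (radius `L^s + 2`) this holds for every coarse bond `ĉ` with `ĉ₋` within `L^s` of the cutoff's
centre block. [cite: Balaban1985BackgroundPropagators, (3.100) p.413, (3.14)–(3.16) p.393; Balaban1985Averaging, (110) p.34] -/
theorem fibre_Qkc_mul_eq_of_eq_one_on_reads (ζ : Site (F.P K) 0 → ℝ)
    (Zb : BondL2K ℂ 3 (periodsT3 F K) c₀ W₂ →ₗ[ℂ] BondL2K ℂ 3 (periodsT3 F K) c₀ W₂)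
    (hZb : ∀ (f : BondL2K ℂ 3 (periodsT3 F K) c₀ W₂) (b : PBond (F.P K) 0), (toL2 F K c₀).symm (Zb f) b = ζ b.src • (toL2 F K c₀).symm f b)
    (chat : PBond (F.P K) (K - n))
    (hζ : ∀ x : Site (F.P K) 0,
      (∀ κ : Fin (F.P K).d, min ((iterBlockOf (K - n) x) κ - chat.src κ).val (chat.src κ - (iterBlockOf (K - n) x) κ).val ≤ 2) → ζ x = 1)
    (f : BondL2K ℂ 3 (periodsT3 F K) c₀ W₂) :
    WL2.equiv ℂ (fun _ : PBond (F.P n) 0 => cB) W₂ (Qkc F n K h c₀ cB W (Zb f)) ((bondShift (sites_eq F n K h)).symm chat)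
      = WL2.equiv ℂ (fun _ : PBond (F.P n) 0 => cB) W₂ (Qkc F n K h c₀ cB W f) ((bondShift (sites_eq F n K h)).symm chat) :=
  fibre_Qkc_congr_of_agree F n K h he hw W hreg (Zb f) f chat fun b hbs _ => by rw [hZb f b, hζ b.src hbs, one_smul]

end Slot

end Summit.QuantumFields.YangMills.Theorems.Prop7QkcReadSet

end
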